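/-
COR-CM (cells pub-hodgecm / pub-hodgecm2, stage 2 of the Hodge ladder) — TRANSPOSITION SURGE, item (vi) sub-binder S2 / (vi-2)
`supply`, PINNING RECORD, part 1 of 3 (REACH HALF `hReach`), SECOND FILE: the E-rational component pin of
`Transposition/Item6PinReach.lean` (p294582, pin-1 gen 0) INSTANTIATED AT THE APPENDIX-C DATUM of
`Literature/NumberTheory/Automorphic/Liu2021/AppendixC/Glue.lean` (liuC-typer-4, p293186): `D := AppendixC.toThm418Data C R`.
Seat prover-pub-hodgecm2-pin-1-g2-0 (pin-1 gen 2; coordinator ruling FINISH-TODAY SWARM 2026-08-21T16:13:55Z (2) «discharging as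
the as-printed files land»; path under the pub-hodgecm2 lead's blanket pre-ACK `Transposition/Item6*`).  THEOREMS ONLY: no definition,
no instance, no named fact, no `variable`, nothing asserted, no proof holes; `h₁`/`h₃` are explicit binders needed only to STATE the
tree surface in the conclusion; every `∀ F`-binder is face-guarded `IsGalois ℚ F → 6 ≤ [F:ℚ] → ι₁ ∈ Φ`.  Nothing in the tree is edited
or restated.  FRAMING: HC_CM is NOT proved.
-/
import Summits.HodgeConjecture.CorCM.B01.Transposition.Item6PinReach
import Literature.NumberTheory.Automorphic.Liu2021.AppendixC.Glue
import Literature.AlgebraicGeometry.Motives.FiberBaseChange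
import Literature.AlgebraicGeometry.Motives.VarietiesProperProofs
import HarnessLib

/-!
# Item (vi) S2, the pinned junction at the Appendix-C datum: `homE`/`hE` discharged, `hComp` split at its printed seams

`Transposition/Item6PinReach.lean` §2 (`Model.pinReach_of_componentPinE`) derives own-htheta's binder `hReach` at the E-rational
component pin from the carriers `D`, `AK`, `Aμ₀`, the Hom tie `homE` + `hE`, and the reading binder `hComp`.  [Liu2021] App. C is now
typed (`AppendixC/PropC5.lean`, `AppendixC/Glue.lean`): Prop. C.5 AS PRINTED (`PropC5AsPrinted`, its witness `IncoherentShimuraSystem`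
with the printed isomorphisms `iso` as DATA), the compactified system `X_K = S̃h(𝕍)_K` (`CompactifiedSystem`, Def. C.8 / l. 4656), the
§4.2 standing data `Sec42Data` (`A_K := Alb_{X_K}` via Liu's own `Albanese`/`Nabla` of Def. 2.1/2.3) and the bridge
`toThm418Data C R : Thm418Data F E` whose `HomK K D_μ` IS `ℚ ⊗_ℤ Hom_E(A_{levelOf K}, A_μ D_μ)` (`toThm418Data_HomK`, `rfl`).

* §1 `Model.pinReach_of_componentPinC` — §2 of the first file AT `D F ι₁ V Φ := toThm418Data (C F ι₁ V Φ) (R F ι₁ V Φ)`,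
  `AK … K := (C …).A ((C …).levelOf K)`, `Aμ₀ … D_μ := (R …).Aμ D_μ`: the Hom tie is `homE := AddMonoidHom.id _`, `hE := injective_id`
  BY `rfl`, so the ONLY remaining binder is `hComp` (read on `Alb_{X_K} ⊗_{E,ι₁} ℂ`).
* §2 `Model.hComp_of_unif_of_alb` — `hComp` at the Appendix-C datum DERIVED from two single-source binders:
  `hUnif` — the complex uniformisation of LIU'S isometry-type Shimura variety `Sh(G(τ), h_{V(τ),ι₁})_{fix τ (K)} ⊗_{ι₁(E)} ℂ` (the
  carrier `PropC5Data.Sh τ ι₁`, Rem. C.2, for `τ ∈ Φ_F` below `ι₁`) as a finite coproduct of smooth projective surfaces, each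
  ball-uniformised by the tree's tautological ball of `V^{ι₁}` with group `ι₁(Γ_c)` for SOME level `Γ_c : Level V` (existential — no
  claim that `Γ_c` is the natural `U(V)(F⁺) ∩ gKg⁻¹` of this `K`; see the V-cplx note in §2) [Deligne 1979 §2.1.2 with Baily–Borel and
  Milne ISV (21)/Thm. 2.14 for the complex structure; NOT a sentence of Liu2021], and
  `hAlb` — «`Alb_{X_K} ⊗_{E,ι₁} ℂ` is the product of the Albanese varieties of the pieces of any finite coproduct decomposition of
  `X_K ⊗_{E,ι₁} ℂ` into smooth projective geometrically irreducible surfaces» [Liu2021 §2.1, the Proposition l. 1190–1200 and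
  Def. 2.3: `Alb` via `∇X`, Galois descent from a splitting field; the tree's `Jacobian` is that universal datum for a geometrically
  irreducible `X`] — USING IN THE KERNEL three printed clauses of App. C: Prop. C.5's isomorphism at the level `levelOf K`
  (`IncoherentShimuraSystem.iso τ ι₁`), «It is projective if `d > 1`» (l. 4656, `CompactifiedSystem.projective_Sh_of`, here
  `d = [F⁺:ℚ] ≥ 3` from `6 ≤ [F:ℚ]`) with «If `Sh(𝕍)_K` is proper, then `S̃h(𝕍)_K = Sh(𝕍)_K`» (`isIso_j_of_isProper`), and transitivity
  of base change `(X ⊗_{E,ι₁} ι₁(E)) ⊗ ℂ ≅ X ⊗_{E,ι₁} ℂ` (tree `Motives.baseChangeHomObjIsoOfComp`, Görtz–Wedhorn 4.16).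
* §3 `Model.pinReach_of_componentPinC_of_unif_of_alb` — the composite: `hReach` at the Appendix-C datum from {`hUnif`, `hAlb`}.

STRENGTH / T5 (coordinator ruling 2026-08-21T15:33:56Z (3)): §1 has ONE hypothesis binder (`hComp`) besides carriers; §2/§3 have the
family {hUnif, hAlb}.  The family is INHABITED by degenerate carriers alone (empty index set with `X_K ⊗ ℂ` and `Alb_{X_K} ⊗ ℂ` initial /
terminal is NOT available for honest carriers, but the consumer's TOKENS `P5.Sh`, `C.cpt.X`, `C.alb` are unconstrained types: e.g.
`hUnif` with `Cset := PEmpty` demands that `Sh(…) ⊗ ℂ` be an initial object, `hAlb` then that `Alb_{X_K} ⊗ ℂ` be terminal — both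
satisfiable by token data), so no contradiction is derivable from {hUnif, hAlb} by themselves; content enters only with the Liu-side
binders `hLiu ∧ hirr ∧ hsm` of the consumer's END display (a non-zero `φ` at small `K`).  Relative to B01-S the classification of
`Item6PinReach.lean` stands (class O at the E-rational pin; no «↔ B01-S» certificate).  What this file changes is bookkeeping of the
residual: `homE`/`hE` are gone; `hComp` ↦ `hUnif` (one non-Liu source, on Liu's isometry-type carrier `P5.Sh τ ι₁` — residual (R1)
= carrier instantiation: that `P5.V τ`, `P5.Gτ τ`, `P5.fix τ`, `P5.Sh τ ι₁` ARE the isometry-type data of the tree's `V` at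
`τ = ι₁|F⁺`) + `hAlb` (one Liu source, §2.1).  No printed HYPOTHESIS of [Liu2021] Thm. 4.18 / App. C fails at a general Galois CM field
of degree `≥ 6` or a general face.  HC_CM is NOT proved.

References: Y. Liu, *Fourier–Jacobi cycles and arithmetic relative trace formula*, Camb. J. Math. 9 (2021) = arXiv:2102.11518
(`FJcycle.tex` md5 6db49a74122d): §2.1 Def. 2.1 l. 1171–1185, Prop. l. 1190–1200, Def. 2.3 l. 1202–1211; §4.2 l. 2053–2076; Def. 4.5 (2)
l. 1944; Thm. 4.18 (1) l. 2239; App. C Rem. C.2 l. 4602–4609, l. 4624, Prop. C.5 l. 4627–4637, Def. C.6 l. 4640–4642, l. 4656, Def. C.8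
l. 4663–4665.  P. Deligne, *Variétés de Shimura* (Corvallis 1979) §2.1.2.  W. Baily, A. Borel, Ann. Math. 84 (1966) Thm. 10.11.
U. Görtz, T. Wedhorn, *Algebraic Geometry I* (2020) Prop. 4.16.  J. Milne, *Introduction to Shimura Varieties* (2005/2017) (21) p. 26, Thm. 2.14,
Lemma 5.13, Thm. 5.17.
-/

noncomputable section

open scoped TensorProduct

namespace Summit.HodgeConjecture.CorCM.Model

open CategoryTheory CategoryTheory.Limits AlgebraicGeometry NumberField
open Literature.AlgebraicGeometry.Motives
open Literature.AlgebraicGeometry.HodgeTheory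
open Literature.AlgebraicGeometry.ShimuraVarieties
open Literature.NumberTheory.Automorphic
open Literature.NumberTheory.Automorphic.PicardCM
open Literature.NumberTheory.Automorphic.Liu2021
open Literature.NumberTheory.Automorphic.Liu2021.AppendixC

/-! ## §1  The E-rational component pin AT THE APPENDIX-C DATUM: `homE`/`hE` by `rfl` -/

section GlueDatum

/-- **`hReach` at the APPENDIX-C DATUM** (`U = picardCMUniverse hHD hI h₁ h₃`; conclusion = own-htheta's binder `hReach` of
`Model.faceSupply_of_thm418AsPrinted_pinned` at the datum family `D F ι₁ V Φ := toThm418Data (C F ι₁ V Φ) (R F ι₁ V Φ)` and the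
E-rational pin `A_μ ⊗_{E,ι₁} ℂ := (letI := ι₁.toAlgebra; ((R …).Aμ D_μ).baseChange ℂ)`).  Carriers, all the CONSUMER'S Appendix-C
presentation of [Liu2021] for its `(F, ι₁, V, Φ)`: `P5 …` = the Prop. C.5 datum (`𝕍`, `𝔾(𝔸_F^∞)`, the fixed `V(τ)`, `G(τ)`,
`𝔾(𝔸_F^∞) ≃ G(τ)(𝔸^∞)`, the systems `Sh(G(τ), h_{V(τ),τ'})`, App. C l. 4618–4624 / Rem. C.2), `iso …` = «`𝕍 ⊗_𝔸 ℚ_p` is isotropic»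
(§4.2 l. 2055), `C …` = the §4.2 standing data (`Sec42Data`: the Shimura varieties for `𝕍` with Prop. C.5's isomorphisms, `X_K`,
`A_K := Alb_{X_K}`), `R …` = the remaining data of Thm. 4.18 (`Thm418Rest`, with `A_μ` «an abelian variety over `E`», Def. 4.5 (2)
l. 1944).  At this datum `HomK K D_μ = ℚ ⊗_ℤ Hom_E(A_{levelOf K}, A_μ D_μ)` BY DEFINITION (`toThm418Data_HomK`), so the Hom tie of
`pinReach_of_componentPinE` is `homE := AddMonoidHom.id _`, `hE := Function.injective_id` and DISAPPEARS; the one remaining binder is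
`hComp` = (U3ᶜ) of `Item6PinReach.lean` read on `Alb_{X_K} ⊗_{E,ι₁} ℂ` with `X_K = S̃h(𝕍)_K` LIU'S scheme (a READING binder, not a
printed sentence — see §2 for its split at the printed seams; not covered by the citation tag).  KERNEL: `pinReach_of_componentPinE`.
HC_CM is NOT proved; `hComp` is not inhabited here.  CITATION SCOPE of the tag: the carrier sentences (Thm. 4.18 (1) l. 2239
`Hom_E(A_K, A_μ)_ℚ`; §4.2 l. 2066 `A_K := Alb_{X_K}`; Def. 4.5 (2) l. 1944 `A_μ` over `E`); the derivation is ours.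
[cite: Liu2021, Thm. 4.18 (1) (FJcycle.tex l. 2239), §4.2 l. 2066 and Def. 4.5 (2) l. 1944 (carriers `Hom_E(A_K, A_μ)_ℚ`, `A_K`, `A_μ`)] -/
theorem pinReach_of_componentPinC
    (h₁ : BallQuotientUniformised) (h₃ : CMAbelianVarietyRealised)
    (P5 : ∀ (F : CMField) (ι₁ : F →+* ℂ) (_ : HermSpace3 F ι₁) (_ : CMType F), PropC5Data (maximalRealSubfield F) F)
    (iso : ∀ (F : CMField) (ι₁ : F →+* ℂ) (_ : HermSpace3 F ι₁) (_ : CMType F), ℕ → Prop)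
    (C : ∀ (F : CMField) (ι₁ : F →+* ℂ) (V : HermSpace3 F ι₁) (Φ : CMType F), Sec42Data (P5 F ι₁ V Φ) (iso F ι₁ V Φ))
    (R : ∀ (F : CMField) (ι₁ : F →+* ℂ) (V : HermSpace3 F ι₁) (Φ : CMType F), Thm418Rest (C F ι₁ V Φ))
    (hComp : ∀ (F : CMField), IsGalois ℚ F → 6 ≤ Module.finrank ℚ F → ∀ (Φ : CMType F) (ι₁ : F →+* ℂ), ι₁ ∈ Φ.1 →
      ∀ V : HermSpace3 F ι₁, ∃ Ksm : Subgroup (toThm418Data (C F ι₁ V Φ) (R F ι₁ V Φ)).G, IsOpenCompact Ksm ∧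
        ∀ K : Subgroup (toThm418Data (C F ι₁ V Φ) (R F ι₁ V Φ)).G, IsOpenCompact K → K ≤ Ksm →
          ∃ (Cset : Type) (_ : Fintype Cset) (X : Cset → SchemeOver ℂ) (B : ∀ c, UnitaryBallUniformisationDatum 2 (X c))
            (Γ : Cset → Level V) (𝒥 : ∀ c, Jacobian (X c))
            (π : ∀ c, (letI := ι₁.toAlgebra; ((C F ι₁ V Φ).A ((C F ι₁ V Φ).levelOf K)).baseChange ℂ) ⟶ (𝒥 c).J),
            (∀ c, (B c).Hℂ = V.Hm.map ι₁) ∧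
            (∀ c, (B c).Γ.map (Matrix.GeneralLinearGroup.map (B c).τ₁) =
              (Γ c).Γ.map (Matrix.GeneralLinearGroup.map ι₁)) ∧
            Nonempty (IsLimit (Fan.mk (letI := ι₁.toAlgebra; ((C F ι₁ V Φ).A ((C F ι₁ V Φ).levelOf K)).baseChange ℂ) π))) :
    ∀ (F : CMField), IsGalois ℚ F → 6 ≤ Module.finrank ℚ F → ∀ (Φ : CMType F) (ι₁ : F →+* ℂ), ι₁ ∈ Φ.1 →
      ∀ V : HermSpace3 F ι₁, ∃ Ksm : Subgroup (toThm418Data (C F ι₁ V Φ) (R F ι₁ V Φ)).G, IsOpenCompact Ksm ∧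
        ∀ (K : Subgroup (toThm418Data (C F ι₁ V Φ) (R F ι₁ V Φ)).G) (Dμ : (toThm418Data (C F ι₁ V Φ) (R F ι₁ V Φ)).Obj)
          (φ : (toThm418Data (C F ι₁ V Φ) (R F ι₁ V Φ)).HomK K Dμ),
          IsOpenCompact K → K ≤ Ksm → φ ≠ 0 →
            ∃ (Γ : Level V) (𝒥 : Jacobian (Var.scheme (ballQuotientUniformisedDatum_of h₁) h₃ (.pms (pmsCode F ι₁ V Γ))))
              (w : 𝒥.J ⟶ (letI := ι₁.toAlgebra; ((R F ι₁ V Φ).Aμ Dμ).baseChange ℂ)), w ≠ 0 :=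
  pinReach_of_componentPinE h₁ h₃ (fun F ι₁ V Φ => toThm418Data (C F ι₁ V Φ) (R F ι₁ V Φ))
    (fun F ι₁ V Φ K => (C F ι₁ V Φ).A ((C F ι₁ V Φ).levelOf K)) (fun F ι₁ V Φ Dμ => (R F ι₁ V Φ).Aμ Dμ)
    (fun _ _ _ _ _ _ => AddMonoidHom.id _) (fun _ _ _ _ _ _ => Function.injective_id) hComp

end GlueDatum

/-! ## §2  `hComp` at the Appendix-C datum, split at the printed seams: Prop. C.5 + Compact Case used in the kernel -/

section Split

/-- **(U3ᶜ) `hComp` at the Appendix-C datum DERIVED from `hUnif` + `hAlb`.**  Two binders, each with ONE source, each demanded only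
for Galois CM `F` with `6 ≤ [F:ℚ]`, `Φ ∋ ι₁`, every `V`:
* `hUnif` — for every `τ ∈ Φ_F` below `ι₁` (`C5.IsAbove τ ι₁`), below some open compact `Ksm ≤ 𝔾(𝔸_F^∞)`, for every open compact
  `K ≤ Ksm` regarded in `G(τ)(𝔸^∞)` through the FIXED isomorphism (`C5.OpenCompactSubgroup.transport ((P5 …).fix τ) K`, Prop. C.5
  l. 4632), LIU'S isometry-type Shimura variety `Sh(G(τ), h_{V(τ),ι₁})_K` over `ι₁(E)` (the carrier `(P5 …).Sh τ ι₁`, §C.1 l. 4599 /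
  Rem. C.2 l. 4602–4609) base-changed to `ℂ` along `ι₁(E) ⊆ ℂ` is a finite COPRODUCT (colimit cofan `inj`) of `ℂ`-surfaces `X c`, each
  with a ball uniformisation `B c : UnitaryBallUniformisationDatum 2 (X c)` of complex Gram matrix `V.Hm^{ι₁}` (the tree's TAUTOLOGICAL
  ball `negCone (V.Hm.map ι₁)`) and group `ι₁(Γ_c)` for SOME level `Γ c : Level V` of the tree's `V`-tower — EXISTENTIAL in `Γ`: the
  binder does NOT say that `Γ c` is the natural level `U(V)(F⁺) ∩ gKg⁻¹` of this `K`.  SOURCE (not Liu2021) and the faithful sentence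
  (V-cplx, s2crux-idea-1 typing constraint 2026-08-21 l.4747, (U-i)): the complex points of `Sh(G, h)_K` are
  `G(ℚ)\[X × G(𝔸^∞)/K] = ⊔_g Γ_g\X⁺`, `Γ_g = G(ℚ)⁺ ∩ gKg⁻¹` [Deligne 1979, §2.1.2], where for Liu's `h_{V,τ'}(z) = diag(1_{n−1}, z/z̄)`
  (App. C l. 4583–4596) at `τ' = ι₁` the hermitian domain `X⁺` is `𝔹(V ⊗_{E,ῑ₁} ℂ)_taut = conj 𝔹(V ⊗_{E,ι₁} ℂ)_taut` [Milne, ISV (21) and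
  Thm. 2.14: `h(z)v = z^{−p} z̄^{−q} v`, `T^{1,0} = Hom(W⁺, W⁻)`], so `X_K ⊗_{E,ι₁} ℂ ≅ ⊔_g conj(P_{Γ_g}(V)@ι₁) ≅ ⊔_g P_{Γ'_g}(V)@ι₁` with
  TRANSPORTED levels `Γ'_g = A·c(Γ_g)·A⁻¹`, `A : (V, c∘Hm) ≅ (V, Hm)` an `E`-isometry (elementary: diagonalise `Hm`; ours) — again
  torsion-free congruence levels of compact opens, i.e. `Level V`'s; the pieces are projective ball quotients (Baily–Borel; compact here),
  torsion-free for `K` neat (tree `UnitaryGroup.torsionFree_arithmeticLevel_map_conj` for `K ≤ K_f(3)`; level constructors in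
  `CorCM/Geometry/LevelConjugate.lean` / `CorCM/LevelConjugate.lean`).  The statement «pieces `= P_{Γ_g}(V)@ι₁` with the NATURAL `Γ_g`» would
  be the `τ' = ῑ₁` instance of Prop. C.5 and is NOT what this binder says.  Residual (R1) = carrier instantiation: that the consumer's
  tokens `(P5 …).V τ`, `.Gτ τ`, `.fix τ`, `.Sh τ ι₁` ARE the isometry-type data `(V, U(V)(𝔸_{F⁺,f}), Sh(Res U(V), h_{V,ι₁}))` of the tree's `V`.
* `hAlb` — for every sufficiently small level `K'` and every finite coproduct decomposition (colimit cofan `inj`) of `X_{K'} ⊗_{E,ι₁} ℂ`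
  (`X_{K'} = S̃h(𝕍)_{K'}` Liu's scheme, `(C …).X K'`) into smooth projective geometrically irreducible surfaces `X c`, there are Albanese
  data `𝒥 c : Jacobian (X c)` and projections exhibiting `Alb_{X_{K'}} ⊗_{E,ι₁} ℂ` (`((C …).A K').baseChange ℂ`, `A_K := Alb_{X_K}` via
  Liu's `∇X`-Albanese `Sec42Data.alb`, Def. 2.3) as the PRODUCT `∏_c Alb_{X_c}` (limit fan).  SOURCE: [Liu2021 §2.1, the Proposition
  l. 1190–1200 with Def. 2.1 (1)–(2) and Def. 2.3]: over a splitting field `∇X = ⊔_i X_i × X_i`, `Alb_X` is built by Galois descent of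
  `∏_i Alb_{X_i}`, hence `Alb_{X ⊗ ℂ} = Alb_X ⊗ ℂ = ∏ Alb_{X_c}` for the geometric components `X_c`, whose `∇ = X_c × X_c` universal
  datum is the tree's `Jacobian (X c)`.
KERNEL (ours): `τ := ` the real embedding under `ι₁|F⁺` (`F⁺ = maximalRealSubfield F`, `mem_maximalRealSubfield_iff`); `Ksm := Ksm_unif ⊓ K₀`;
for open compact `K ≤ Ksm` the level `levelOf K = K` (`Sec42Data.coe_levelOf`); `X_K ⊗_{E,ι₁} ℂ ≅ Sh(𝕍)_K ⊗_{E,ι₁} ℂ` by «projective if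
`d > 1`» (`CompactifiedSystem.projective_Sh_of`, `d = [F⁺:ℚ] = [F:ℚ]/2 ≥ 3`; `IsProjectiveOver.isProper`; `isIso_j_of_isProper`)
`≅ (Sh(𝕍)_K ⊗_{E,ι₁} ι₁(E)) ⊗ ℂ` (`baseChangeHomObjIsoOfComp`) `≅ Sh(G(τ), h_{V(τ),ι₁})_{fix τ K} ⊗ ℂ` (Prop. C.5: `(C …).S.iso τ ι₁`
at `levelOf K`); transport `hUnif`'s cofan along it; apply `hAlb`.  HC_CM is NOT proved; `hUnif`, `hAlb` are not inhabited here.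
CITATION SCOPE of the tag: Prop. C.5 (the isomorphism), l. 4656 (projective if `d > 1`; `S̃h = Sh` if proper), §4.2 l. 2066 / Def. 2.3
(`A_K := Alb_{X_K}`) — the clauses the kernel USES; `hUnif` is Deligne's, `hAlb` is Liu §2.1's, the derivation is ours.
[cite: Liu2021, Prop. C.5 (FJcycle.tex l. 4627–4637), App. C l. 4656, §4.2 l. 2060–2066, Def. 2.3 and the Proposition l. 1190–1200]
[cite: Deligne1979ShimuraVarieties, §2.1.2] -/
theorem hComp_of_unif_of_alb
    (P5 : ∀ (F : CMField) (ι₁ : F →+* ℂ) (_ : HermSpace3 F ι₁) (_ : CMType F), PropC5Data (maximalRealSubfield F) F)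
    (iso : ∀ (F : CMField) (ι₁ : F →+* ℂ) (_ : HermSpace3 F ι₁) (_ : CMType F), ℕ → Prop)
    (C : ∀ (F : CMField) (ι₁ : F →+* ℂ) (V : HermSpace3 F ι₁) (Φ : CMType F), Sec42Data (P5 F ι₁ V Φ) (iso F ι₁ V Φ))
    (hUnif : ∀ (F : CMField), IsGalois ℚ F → 6 ≤ Module.finrank ℚ F → ∀ (Φ : CMType F) (ι₁ : F →+* ℂ), ι₁ ∈ Φ.1 →
      ∀ (V : HermSpace3 F ι₁) (τ : maximalRealSubfield F →+* ℝ), C5.IsAbove τ ι₁ →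
        ∃ Ksm : Subgroup (P5 F ι₁ V Φ).G, IsOpenCompact Ksm ∧
          ∀ K : C5.OpenCompactSubgroup (P5 F ι₁ V Φ).G, K.1 ≤ Ksm →
            ∃ (Cset : Type) (_ : Fintype Cset) (X : Cset → SchemeOver ℂ) (B : ∀ c, UnitaryBallUniformisationDatum 2 (X c))
              (Γ : Cset → Level V)
              (inj : ∀ c, X c ⟶ (baseChangeHom ι₁.fieldRange.subtype).obj
                (((P5 F ι₁ V Φ).Sh τ ι₁).obj (C5.OpenCompactSubgroup.transport ((P5 F ι₁ V Φ).fix τ) K))),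
              (∀ c, (B c).Hℂ = V.Hm.map ι₁) ∧
              (∀ c, (B c).Γ.map (Matrix.GeneralLinearGroup.map (B c).τ₁) =
                (Γ c).Γ.map (Matrix.GeneralLinearGroup.map ι₁)) ∧
              Nonempty (IsColimit (Cofan.mk _ inj)))
    (hAlb : ∀ (F : CMField), IsGalois ℚ F → 6 ≤ Module.finrank ℚ F → ∀ (Φ : CMType F) (ι₁ : F →+* ℂ), ι₁ ∈ Φ.1 →
      ∀ (V : HermSpace3 F ι₁) (K' : C5.SmallLevel (C F ι₁ V Φ).S.K₀) (Cset : Type) (_ : Fintype Cset) (X : Cset → SchemeOver ℂ)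
        (inj : ∀ c, X c ⟶ (baseChangeHom ι₁).obj ((C F ι₁ V Φ).X K')),
        (∀ c, IsSmoothProjective 2 (X c)) → Nonempty (IsColimit (Cofan.mk _ inj)) →
          ∃ (𝒥 : ∀ c, Jacobian (X c)) (π : ∀ c, (letI := ι₁.toAlgebra; ((C F ι₁ V Φ).A K').baseChange ℂ) ⟶ (𝒥 c).J),
            Nonempty (IsLimit (Fan.mk (letI := ι₁.toAlgebra; ((C F ι₁ V Φ).A K').baseChange ℂ) π))) :
    ∀ (F : CMField), IsGalois ℚ F → 6 ≤ Module.finrank ℚ F → ∀ (Φ : CMType F) (ι₁ : F →+* ℂ), ι₁ ∈ Φ.1 →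
      ∀ V : HermSpace3 F ι₁, ∃ Ksm : Subgroup (C F ι₁ V Φ).G, IsOpenCompact Ksm ∧
        ∀ K : Subgroup (C F ι₁ V Φ).G, IsOpenCompact K → K ≤ Ksm →
          ∃ (Cset : Type) (_ : Fintype Cset) (X : Cset → SchemeOver ℂ) (B : ∀ c, UnitaryBallUniformisationDatum 2 (X c))
            (Γ : Cset → Level V) (𝒥 : ∀ c, Jacobian (X c))
            (π : ∀ c, (letI := ι₁.toAlgebra; ((C F ι₁ V Φ).A ((C F ι₁ V Φ).levelOf K)).baseChange ℂ) ⟶ (𝒥 c).J),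
            (∀ c, (B c).Hℂ = V.Hm.map ι₁) ∧
            (∀ c, (B c).Γ.map (Matrix.GeneralLinearGroup.map (B c).τ₁) =
              (Γ c).Γ.map (Matrix.GeneralLinearGroup.map ι₁)) ∧
            Nonempty (IsLimit (Fan.mk (letI := ι₁.toAlgebra; ((C F ι₁ V Φ).A ((C F ι₁ V Φ).levelOf K)).baseChange ℂ) π)) := by
  intro F hG h6 Φ ι₁ hι V
  -- the real embedding `τ` of `F⁺ = maximalRealSubfield F` under `ι₁`
  have hreal : ComplexEmbedding.IsReal (ι₁.comp (algebraMap (maximalRealSubfield F) F)) := by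
    rw [ComplexEmbedding.isReal_iff]
    ext x
    rw [ComplexEmbedding.conjugate_coe_eq]
    exact (mem_maximalRealSubfield_iff (x : F)).1 x.2 ι₁
  set τ : maximalRealSubfield F →+* ℝ := hreal.embedding
  have hτ : C5.IsAbove τ ι₁ := by
    ext x
    simp [τ, ComplexEmbedding.IsReal.coe_embedding_apply]
  -- thresholds: `hUnif`'s `Ksm` and the system's `K₀`
  obtain ⟨KsmU, hKsmU, hunif⟩ := hUnif F hG h6 Φ ι₁ hι V τ hτ
  set K₀ := (C F ι₁ V Φ).S.K₀
  refine ⟨KsmU ⊓ K₀.1, ⟨?_, ?_⟩, fun K hK hle => ?_⟩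
  · simpa only [Subgroup.coe_inf] using hKsmU.1.inter K₀.2.1
  · simpa only [Subgroup.coe_inf] using K₀.2.2.inter_left (Subgroup.isClosed_of_isOpen _ hKsmU.1)
  have hleU : K ≤ KsmU := hle.trans inf_le_left
  have hle₀ : K ≤ K₀.1 := hle.trans inf_le_right
  -- the level `K' := levelOf K`, `= K` as a subgroup
  set K' : C5.SmallLevel K₀ := (C F ι₁ V Φ).levelOf K
  have hcoe : ((K'.1 : C5.OpenCompactSubgroup _) : Subgroup (C F ι₁ V Φ).G) = K := (C F ι₁ V Φ).coe_levelOf hK hle₀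
  have hK'U : (K'.1 : Subgroup (C F ι₁ V Φ).G) ≤ KsmU := by rw [hcoe]; exact hleU
  -- `hUnif` at the level `K'` regarded in `G(τ)(𝔸^∞)`
  obtain ⟨Cset, _, X, B, Γ, inj, hH, hΓ, ⟨hcol⟩⟩ := hunif K'.1 hK'U
  -- `d = [F⁺ : ℚ] > 1`: the Compact Case, `Sh(𝕍)_K` projective hence proper, `X_K = Sh(𝕍)_K`
  have hd : 1 < Module.finrank ℚ (maximalRealSubfield F) := by
    have hmul := Module.finrank_mul_finrank ℚ (maximalRealSubfield F) F
    rw [Algebra.IsQuadraticExtension.finrank_eq_two (maximalRealSubfield F) F] at hmul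
    omega
  have hproj : IsProjectiveOver ((C F ι₁ V Φ).S.Sh𝕍.obj K') := (C F ι₁ V Φ).cpt.projective_Sh_of (Or.inl hd) K'
  haveI : IsProper ((C F ι₁ V Φ).S.Sh𝕍.obj K').hom := hproj.isProper
  haveI : IsIso ((C F ι₁ V Φ).cpt.j.app K') := (C F ι₁ V Φ).cpt.isIso_j_of_isProper K' inferInstance
  -- `X_K ⊗_{E,ι₁} ℂ ≅ Sh(G(τ), h_{V(τ),ι₁})_{fix τ K} ⊗ ℂ`
  have hcomp : (ι₁.fieldRange.subtype).comp ι₁.rangeRestrictField = ι₁ := RingHom.ext fun _ => rfl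
  let e : (baseChangeHom ι₁).obj ((C F ι₁ V Φ).X K') ≅
      (baseChangeHom ι₁.fieldRange.subtype).obj
        (((P5 F ι₁ V Φ).Sh τ ι₁).obj (C5.OpenCompactSubgroup.transport ((P5 F ι₁ V Φ).fix τ) K'.1)) :=
    ((baseChangeHom ι₁).mapIso (asIso ((C F ι₁ V Φ).cpt.j.app K'))).symm ≪≫
      (baseChangeHomObjIsoOfComp ι₁.rangeRestrictField ι₁.fieldRange.subtype ι₁ hcomp ((C F ι₁ V Φ).S.Sh𝕍.obj K')).symm ≪≫
      (baseChangeHom ι₁.fieldRange.subtype).mapIso (((C F ι₁ V Φ).S.iso τ ι₁ hτ).app K')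
  -- transport the coproduct decomposition to `X_K ⊗ ℂ`
  let inj' : ∀ c, X c ⟶ (baseChangeHom ι₁).obj ((C F ι₁ V Φ).X K') := fun c => inj c ≫ e.inv
  have hcol' : Nonempty (IsColimit (Cofan.mk _ inj')) :=
    ⟨hcol.ofIsoColimit (Cofan.ext e.symm (fun c => rfl))⟩
  -- Albanese: product decomposition of `Alb_{X_K} ⊗ ℂ`
  obtain ⟨𝒥, π, hlim⟩ := hAlb F hG h6 Φ ι₁ hι V K' Cset inferInstance X inj' (fun c => (B c).isSmoothProjective) hcol'
  exact ⟨Cset, inferInstance, X, B, Γ, 𝒥, π, hH, hΓ, hlim⟩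

end Split

/-! ## §3  The composite: `hReach` at the Appendix-C datum from {`hUnif`, `hAlb`} -/

section Composite

/-- **`hReach` at the APPENDIX-C DATUM from the two single-source binders** `hUnif` (Deligne 1979 §2.1.2 on Liu's isometry-type
carrier `Sh(G(τ), h_{V(τ),ι₁})`, App. C Rem. C.2) and `hAlb` ([Liu2021 §2.1 Prop.] Albanese vs. base change and components) of
`hComp_of_unif_of_alb`, composed with `pinReach_of_componentPinC`: own-htheta's `hReach` VERBATIM at
`D F ι₁ V Φ := toThm418Data (C F ι₁ V Φ) (R F ι₁ V Φ)`, `Aμ … D_μ := (letI := ι₁.toAlgebra; ((R …).Aμ D_μ).baseChange ℂ)`.  Binder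
family {hUnif, hAlb} (+ the consumer's carriers `P5`, `iso`, `C`, `R`, and `h₁`/`h₃` to state the tree surface); the kernel uses
Prop. C.5's isomorphism, «projective if `d > 1`», `S̃h = Sh` when proper, `HomK = ℚ ⊗ Hom_E(A_K, A_μ)` (all App. C / §4.2 as typed in
`AppendixC/Glue.lean`) and the tree theorems listed in `Item6PinReach.lean` §1.  HC_CM is NOT proved; `hUnif`, `hAlb` are not
inhabited here.  CITATION SCOPE of the tag: as for §1 and §2.
[cite: Liu2021, Thm. 4.18 (1) (FJcycle.tex l. 2239), §4.2 l. 2060–2066, Def. 2.3, Def. 4.5 (2) l. 1944, Prop. C.5 l. 4627–4637, App. C l. 4656]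
[cite: Deligne1979ShimuraVarieties, §2.1.2] -/
theorem pinReach_of_componentPinC_of_unif_of_alb
    (h₁ : BallQuotientUniformised) (h₃ : CMAbelianVarietyRealised)
    (P5 : ∀ (F : CMField) (ι₁ : F →+* ℂ) (_ : HermSpace3 F ι₁) (_ : CMType F), PropC5Data (maximalRealSubfield F) F)
    (iso : ∀ (F : CMField) (ι₁ : F →+* ℂ) (_ : HermSpace3 F ι₁) (_ : CMType F), ℕ → Prop)
    (C : ∀ (F : CMField) (ι₁ : F →+* ℂ) (V : HermSpace3 F ι₁) (Φ : CMType F), Sec42Data (P5 F ι₁ V Φ) (iso F ι₁ V Φ))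
    (R : ∀ (F : CMField) (ι₁ : F →+* ℂ) (V : HermSpace3 F ι₁) (Φ : CMType F), Thm418Rest (C F ι₁ V Φ))
    (hUnif : ∀ (F : CMField), IsGalois ℚ F → 6 ≤ Module.finrank ℚ F → ∀ (Φ : CMType F) (ι₁ : F →+* ℂ), ι₁ ∈ Φ.1 →
      ∀ (V : HermSpace3 F ι₁) (τ : maximalRealSubfield F →+* ℝ), C5.IsAbove τ ι₁ →
        ∃ Ksm : Subgroup (P5 F ι₁ V Φ).G, IsOpenCompact Ksm ∧
          ∀ K : C5.OpenCompactSubgroup (P5 F ι₁ V Φ).G, K.1 ≤ Ksm →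
            ∃ (Cset : Type) (_ : Fintype Cset) (X : Cset → SchemeOver ℂ) (B : ∀ c, UnitaryBallUniformisationDatum 2 (X c))
              (Γ : Cset → Level V)
              (inj : ∀ c, X c ⟶ (baseChangeHom ι₁.fieldRange.subtype).obj
                (((P5 F ι₁ V Φ).Sh τ ι₁).obj (C5.OpenCompactSubgroup.transport ((P5 F ι₁ V Φ).fix τ) K))),
              (∀ c, (B c).Hℂ = V.Hm.map ι₁) ∧
              (∀ c, (B c).Γ.map (Matrix.GeneralLinearGroup.map (B c).τ₁) =
                (Γ c).Γ.map (Matrix.GeneralLinearGroup.map ι₁)) ∧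
              Nonempty (IsColimit (Cofan.mk _ inj)))
    (hAlb : ∀ (F : CMField), IsGalois ℚ F → 6 ≤ Module.finrank ℚ F → ∀ (Φ : CMType F) (ι₁ : F →+* ℂ), ι₁ ∈ Φ.1 →
      ∀ (V : HermSpace3 F ι₁) (K' : C5.SmallLevel (C F ι₁ V Φ).S.K₀) (Cset : Type) (_ : Fintype Cset) (X : Cset → SchemeOver ℂ)
        (inj : ∀ c, X c ⟶ (baseChangeHom ι₁).obj ((C F ι₁ V Φ).X K')),
        (∀ c, IsSmoothProjective 2 (X c)) → Nonempty (IsColimit (Cofan.mk _ inj)) →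
          ∃ (𝒥 : ∀ c, Jacobian (X c)) (π : ∀ c, (letI := ι₁.toAlgebra; ((C F ι₁ V Φ).A K').baseChange ℂ) ⟶ (𝒥 c).J),
            Nonempty (IsLimit (Fan.mk (letI := ι₁.toAlgebra; ((C F ι₁ V Φ).A K').baseChange ℂ) π))) :
    ∀ (F : CMField), IsGalois ℚ F → 6 ≤ Module.finrank ℚ F → ∀ (Φ : CMType F) (ι₁ : F →+* ℂ), ι₁ ∈ Φ.1 →
      ∀ V : HermSpace3 F ι₁, ∃ Ksm : Subgroup (toThm418Data (C F ι₁ V Φ) (R F ι₁ V Φ)).G, IsOpenCompact Ksm ∧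
        ∀ (K : Subgroup (toThm418Data (C F ι₁ V Φ) (R F ι₁ V Φ)).G) (Dμ : (toThm418Data (C F ι₁ V Φ) (R F ι₁ V Φ)).Obj)
          (φ : (toThm418Data (C F ι₁ V Φ) (R F ι₁ V Φ)).HomK K Dμ),
          IsOpenCompact K → K ≤ Ksm → φ ≠ 0 →
            ∃ (Γ : Level V) (𝒥 : Jacobian (Var.scheme (ballQuotientUniformisedDatum_of h₁) h₃ (.pms (pmsCode F ι₁ V Γ))))
              (w : 𝒥.J ⟶ (letI := ι₁.toAlgebra; ((R F ι₁ V Φ).Aμ Dμ).baseChange ℂ)), w ≠ 0 :=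
  pinReach_of_componentPinC h₁ h₃ P5 iso C R (hComp_of_unif_of_alb P5 iso C hUnif hAlb)

end Composite

end Summit.HodgeConjecture.CorCM.Model

end
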